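import Summits.QuantumFields.BalabanUV.T4Continuum.Spine.NE1p.DressedTransportAssembledWitness
import Summits.QuantumFields.BalabanUV.T4Continuum.Spine.NE1p.DressedTransportAssembledModWinData

/-!
# T⁴ programme, spine estimate NE1′ (node O3b/H2) — NON-VACUITY OF THE MODULI FACES: END-F′-mod and END-F′-mod-win (over the
# canonical data) BY NAME ON THE W2 DATUM, THEN END-B's PER-CUTOFF FACE (formalisation crew `b2b-balaban-t4-ne1p-formalise-*`,
# leaf seat 01 gen 2, witness item W6 in row S2's scope)

Cell `pub-balaban`, sub-cell `t4`, BINDER-OWNERS row NE1′; tree target `Summits/QuantumFields/BalabanUV/T4Continuum/Spine/NE1p/`;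
ADDITIVE — imports leaf-03's witness `Spine/NE1p/DressedTransportAssembledWitness` (row W2 part 3, p213390: the `K = 2` two-atom
datum `TrA`/`Fn`/`WinA`/`𝒜A`/`𝒬A`/`SgA`/`SA`/`sA`/`mA`/`cA`/`δfA`/… and ALL its binder lemmas, the rational `assembledConstants` and
the leaf bundle `assembledLeaves`) and this seat's `Spine/NE1p/DressedTransportAssembledModWinData` (row S2j, p214087; through it
S2i `transportLeaf_assembled_mod_canonical`, leaf-08's END-F′-mod p213245 ∕ END-F′-mod-win p213818) ONLY; modifies nothing.

WHY.  The moduli lineage of the transport leaf — leaf-08's END-F′-mod (the Assembly's `hP` produced from the live generations'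
transported RESPONSE MODULI, no chart-radius floor, cutoff-free source condition `‖c b k‖ ≤ m`; finding F-ne1pleaf08-1 = LF-1
dissolved) and END-F′-mod-win (the same under END-F-win's per-step bond-ball windows), in this seat's canonical-data forms S2i∕S2j
(no bookkeeping functions displayed) — had no joint-satisfiability certificate: row W2 (leaf-03) inhabits END-F″∕END-F′ (uniform
floor `r_* = 1` with `‖c‖·r = m·r_*`), W1 END-F, W3 the absorption door, W4 the quantifier separation, W5 the tower.  This file
re-uses leaf-03's datum UNCHANGED and shows that the moduli faces' binder families are inhabited on it too:
* §1 **`assembledLeavesMod`** — the `BookingLeaves` bundle whose transport leaf `htr` IS `transportLeaf_assembled_mod_canonical`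
  (S2i) ON THE DATUM, all 42 hypothesis binders discharged by leaf-03's lemmas BY NAME (recorded as the FIELD `htr`, not as a theorem:
  its statement is leaf-03's `transportsFromVar_assembled` verbatim — the ROUTE is what is new).  What differs from W2's `transportsFromVar_assembled`: there is NO `hrstar`/`hrstar_r`/
  `hϱfloor`; the source condition is `hcm : ‖cA‖ ≤ mA` (‖cA‖ = 2⁻²⁶ ≤ 2⁻²⁴ — slack 4, where END-F′'s `‖c‖·r = m·r_*` held with
  EQUALITY); the step budget is the closed form `s1Mod` and is NOT a hypothesis (it is `≤ m·Σ envVar` outright,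
  `DressedTransportAssembledMod.budgetShare_le_mod`).  `htr`'s type = W2's VERBATIM: `TrA.TransportsFromVar (4·(1/5)/4)
  (fun _ => 1·128) (budgetGate TrA sA mA SA (4·(1/5)/4) (fun _ => 1·128))` — the field type of `BookingLeaves.htr`; `sourceSlack`
  records `4·‖cA‖ = mA`.
* §2 **`assembledLeavesModWin`** — the same with `htr` through `transportLeaf_assembled_mod_win_canonical` (S2j) on the datum with the
  per-step windows `wk := 1` (= `w`): `hθwk`/`hwk`/`hwk_anti` by reflexivity, `hdefwk : 1/5 ≤ 1`, `hδfwk : 1/100 ≤ 1`, `hN2`'s guard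
  `latN p ≤ 1` as in W2 — the per-step-window moduli face's 46 binders jointly inhabited.
* §3 **`gates_through_ENDFmod`**/**`gates_through_ENDFmodWin`**: `ClassAt Bk 64 128 1 ∧ budgetGate … 0 ∧ budgetGate … 1` through
  `DressedRoot.classAt_of_bookingLeaves` on the bundles of §1/§2 — END-F′-mod(-win) THEN END-B's per-cutoff face, end to end at
  function level.

WHAT THIS IS NOT.  Not an estimate; not the tower-level witness; nothing of Bałaban's densities; the wall (w1)–(w7) of
`t4/T4-EST-NE1p-P1.md` §4 is unchanged; the cross-family margins are served at the uniform slice window `w = 1` (finding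
F-ne1pleaf04-1 = LF-2 is about cutoff-free INSTANTIATION along long trajectories, invisible at `K = 2`).  VALUE = a
joint-satisfiability certificate for the moduli faces' binder SHAPES together with END-B's per-cutoff leaf binders and a
non-trivial dressed budget (W2's `not_budgetGate_of_unit_source` applies verbatim: same gate).

HONEST FRAMING.  Rung (B)+1 bookkeeping on ONE finite four-torus of fixed physical size — NOT infinite volume, NOT a mass gap, NOT
OS on ℝ⁴, NOT the Clay problem, NOT summit progress.  NE1′ is NOT PRINTED and NOT PROVED; every headline reads «NE1′ ⇐ the named
binders» ∕ «L-T ⇐ F-1…F-9»; spine PROVED 0∕9 unchanged.  A TOY: nothing of Bałaban's densities or of [Balaban1989LargeFieldII]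
(1.71)–(1.75) pp. 379–380 is encoded (CONTEXT only, carried by the imported headers); no `def … : Prop`; every declaration is
[folklore] toy kernel mathematics, 0 sorry, 0 citations.  HONEST DEPENDENCY: continuum YM on T⁴ ⇐ BetaPertH ∧ nine spine
estimates (0/9 proved); BetaPertH ⇐ (D1) ∧ (D4) ∧ CAP+tail; G-an2-4 gates asym, D1 and NE2/3/4.
-/

noncomputable section

namespace Summit.QuantumFields.BalabanUV.T4Continuum.NE1p.DressedTransportAssembledModWitness

open MeasureTheory Set Metric Filter Finset
open scoped BigOperators
open Literature.MathematicalPhysics.QuantumFieldTheory.Balaban1983to89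
open Literature.MathematicalPhysics.QuantumFieldTheory.Balaban1983to89.T4TermFormat
open Literature.MathematicalPhysics.QuantumFieldTheory.Balaban1983to89.T4TermFormat.Booking
open Literature.MathematicalPhysics.QuantumFieldTheory.Balaban1983to89.T4GatedBooking
open Literature.MathematicalPhysics.QuantumFieldTheory.Balaban1983to89.T4TrajectoryComparison
open T4TrajectoryModulus (bondBall bondBall_add_mem bondBall_latMove_add_mem bondBall_diam)
open T4BlockTransport (Fld NDir latMove latN Site norm_dir_le)
open T4BirthChartTransport (GaugeInvariant BirthSlice RelGauge)
open T4TrajectoryDensity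
open Summit.QuantumFields.BalabanUV.T4Continuum.T4TrajectoryDensityDressed
open Summit.QuantumFields.BalabanUV.T4Continuum.T4TrajectoryDensityWitness
open Summit.QuantumFields.BalabanUV.T4Continuum.NE1p.DressedRoot
open Summit.QuantumFields.BalabanUV.T4Continuum.NE1p.DressedTransportAssembledData
open Summit.QuantumFields.BalabanUV.T4Continuum.NE1p.DressedTransportAssembledModData
open Summit.QuantumFields.BalabanUV.T4Continuum.NE1p.DressedTransportAssembledModWinData
open Summit.QuantumFields.BalabanUV.T4Continuum.NE1p.DressedTransportAssembledWitness

/-! ## §1 END-F′-mod (canonical data) on the datum: the leaf bundle with `htr` THROUGH THE MODULI FACE, gated by the dressed budget -/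

/-- **THE JOINT WITNESS FOR `transportLeaf_assembled_mod_canonical` — ALL 42 hypothesis binders of the moduli face discharged at once
on leaf-03's datum, as the transport leaf `htr` of a `BookingLeaves` bundle** (every other field is leaf-03's `assembledLeaves`
verbatim: ONE rational `UniformConstants`, K- and μ-free).  The gate is the dressed budget `budgetGate TrA sA mA SA (4c_δ/r) (ψ·α)`
itself, the observable-attached exponent is GIVEN BY THE ASSEMBLY'S DICTIONARY `hQ` with a live generation at both met steps, genuine
fresh pairs at both atoms, canonical sizes `aszRec` ∕ budgets `s1Mod` ∕ radii `rsOf` inside (not displayed), shrinking chart radii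
`ϱA k = 1 + 2^{1−k} < r = 4`, NO radius floor, source condition `‖cA‖ ≤ mA` with slack.  The `htr` so obtained has W2's type
VERBATIM (the field type of `BookingLeaves.htr` at `C = 4·(1/5)/4`, `ρ ≡ 1·128`) — which is why it is recorded as a FIELD and not
re-stated as a theorem (the statement is leaf-03's `transportsFromVar_assembled`; only the ROUTE differs). [folklore] -/
def assembledLeavesMod : BookingLeaves assembledConstants Bk TrA :=
  { assembledLeaves with
  htr := transportLeaf_assembled_mod_canonical (T := TrA) (Fn := fun _ k' k => Fn k' k)
    (rel := fun _ _ _ U U' => U = U') (𝒦 := fun _ _ k => WinA k) (ref := fun _ _ => ref₁) (base := fun _ _ => base₁)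
    (𝒜 := fun b k => 𝒜A k b) (𝒬 := fun b k => 𝒬A k b) (q := fun _ _ => qA) (μ := fun _ _ => flTwo) (z₀ := fun _ _ => 0)
    (z₁ := fun _ _ => z₁A) (D := fun _ _ => Dfl) (defect := fun _ _ _ => 1 / 5) (cδ := 1 / 5) (ψ := 1) (w := 1) (r := 4)
    (m := mA) (s := sA) (θ := fun _ _ => 1) (ϱ₁ := fun _ k => ϱ₁A k) (α := fun _ => 128)
    (ϱ := fun _ _ k => ϱA k) (S := SA) (Sg := SgA) (c := fun _ _ => cA) (δf := fun _ _ _ => δfA)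
    (fun _ => by norm_num) (by norm_num) one_pos (by norm_num) zero_le_one
    (fun b k' hb hk hran => hsl_A b k' _ hb hk hran)
    (fun b k' k _ hk'k _ _ U => by rw [𝒜A_add_𝒬A]; exact Fn_succ hk'k U)
    (fun _ _ _ _ _ _ _ _ => mem_bddClass _) (fun _ _ => ⟨0, zero_mem_Dfl⟩) (fun _ _ k => ϱA_pos k)
    (fun b _ k _ _ hk _ => realBaseAt_A (by change k + 1 ≤ 2 at hk; omega) b
      (by simp only [radA]; push_cast; linarith))
    (fun b _ k _ _ hk _ => by
      have hk1 : k ≤ 1 := by change k + 1 ≤ 2 at hk; omega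
      interval_cases k
      · exact exponentSliceAt_A_zero b (by norm_num [radA])
      · exact exponentSliceAt_A_one b (by norm_num [radA]))
    (fun b k => by funext U z; simp only [𝒬A, add_sub_cancel_left])
    hSg_A
    (fun _ k'' _ => (ϱA_le_three k'').trans_lt (by norm_num))
    (fun _ _ k _ _ => ϱA_succ_lt k)
    (fun b _ k _ _ => hmargin_A b k)
    (fun _ _ => by rw [norm_cA, mA]; norm_num)
    (fun _ k p _ => ⟨by norm_num [δfA], by norm_num [δfA]⟩)
    (fun _ _ _ _ => by norm_num [δfA])
    (fun _ _ => ae_two.mpr ⟨zero_mem_Dfl, atomH_mem_Dfl⟩)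
    (fun _ _ k _ _ _ => bondBall_add_mem (ρ' := radA (k + 1)) (s := 1 / 2) (ρ := radA k)
      (by simp only [radA]; push_cast; linarith))
    (fun _ _ k _ _ _ => bondBall_latMove_add_mem (ρ' := radA (k + 1)) (w := 1) (s := 1 / 2) (ρ := radA k)
      (by simp only [radA]; push_cast; linarith))
    (fun _ _ k _ _ _ _ => bondBall_add_mem (ρ' := radA (k + 1)) (s := 1 / 2) (ρ := radA k)
      (by simp only [radA]; push_cast; linarith))
    (fun _ _ k _ _ _ _ U₀ hU₀ pd hpd hpdw t ht =>
      bondBall_complexMargin (ρ' := radA (k + 1)) (w := 1) (ϱ₁ := ϱ₁A k) (s := 1 / 2) (ρ := radA k) (ϱ₁A_pos k).le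
        (by have := ϱ₁A_le_four k; simp only [radA]; push_cast; linarith) U₀ hU₀ pd hpd hpdw t ht z₁A z₁A_mem)
    (fun _ _ _ _ _ _ _ U₀ _ pd _ _ => ae_two.mpr
      ⟨fun t _ => relGauge_pair (latMove U₀ pd t) 0 (Or.inl rfl), fun t _ => relGauge_pair (latMove U₀ pd t) atomH (Or.inr rfl)⟩)
    (fun _ _ z hz z' hz' x ν => by have h := bondBall_diam (s := 1 / 2) z hz z' hz' x ν; linarith)
    (fun _ _ => ⟨one_pos, le_rfl⟩)
    (fun _ _ k _ _ _ => by
      have h1 := one_le_ϱA k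
      have h4 : 4 * (1 : ℝ) / ϱA k ≤ 4 := by
        rw [div_le_iff₀ (ϱA_pos k)]; linarith
      nlinarith [five_mul_exp_three_le, Real.exp_pos 3])
    (fun _ _ _ _ _ h => h ▸ rfl)
    (fun _ _ _ _ _ => aesm_two _)
    (fun _ _ _ => by norm_num) (fun _ _ _ _ _ _ => by norm_num)
    (fun b k' k hb hk'k hk hran => hlin_A b k' k _ hb hk'k hk hran) }

/-- The moduli face's source condition holds on the datum with slack `4`: `4·‖cA‖ = mA` (W2 chose `‖c‖·r = m·r_*` with `r = 4`,
`r_* = 1`), while END-F′-mod asks only `‖c‖ ≤ m`. [arith] [folklore] -/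
theorem sourceSlack : 4 * ‖cA‖ = mA := by
  rw [norm_cA, mA]; norm_num

/-! ## §2 END-F′-mod-win (canonical data) on the datum: per-step windows `wk ≡ 1` -/

/-- **THE JOINT WITNESS FOR `transportLeaf_assembled_mod_win_canonical` — ALL 46 hypothesis binders of the per-step-window moduli face
discharged at once on leaf-03's datum, as the `htr` of a `BookingLeaves` bundle**, with the per-step chart/slice windows
`wk b k′ k := 1` (the uniform `w`; non-increasing trivially, `θ = 1 ≤ wk`, `defect = 1/5 ≤ wk`, `δf = 1/100 ≤ wk`), everything else as
in §1; `htr`'s type = W2's VERBATIM. [folklore] -/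
def assembledLeavesModWin : BookingLeaves assembledConstants Bk TrA :=
  { assembledLeaves with
  htr := transportLeaf_assembled_mod_win_canonical (T := TrA) (Fn := fun _ k' k => Fn k' k)
    (rel := fun _ _ _ U U' => U = U') (𝒦 := fun _ _ k => WinA k) (ref := fun _ _ => ref₁) (base := fun _ _ => base₁)
    (𝒜 := fun b k => 𝒜A k b) (𝒬 := fun b k => 𝒬A k b) (q := fun _ _ => qA) (μ := fun _ _ => flTwo) (z₀ := fun _ _ => 0)
    (z₁ := fun _ _ => z₁A) (D := fun _ _ => Dfl) (defect := fun _ _ _ => 1 / 5) (cδ := 1 / 5) (ψ := 1) (w := 1) (r := 4)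
    (m := mA) (s := sA) (θ := fun _ _ => 1) (ϱ₁ := fun _ k => ϱ₁A k) (α := fun _ => 128)
    (ϱ := fun _ _ k => ϱA k) (wk := fun _ _ _ => 1) (S := SA) (Sg := SgA) (c := fun _ _ => cA) (δf := fun _ _ _ => δfA)
    (fun _ => by norm_num) (by norm_num) one_pos (by norm_num) zero_le_one
    (fun b k' hb hk hran => hsl_A b k' _ hb hk hran)
    (fun b k' k _ hk'k _ _ U => by rw [𝒜A_add_𝒬A]; exact Fn_succ hk'k U)
    (fun _ _ _ _ _ _ _ _ => mem_bddClass _) (fun _ _ => ⟨0, zero_mem_Dfl⟩) (fun _ _ k => ϱA_pos k)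
    (fun b _ k _ _ hk _ => realBaseAt_A (by change k + 1 ≤ 2 at hk; omega) b
      (by simp only [radA]; push_cast; linarith))
    (fun b _ k _ _ hk _ => by
      have hk1 : k ≤ 1 := by change k + 1 ≤ 2 at hk; omega
      interval_cases k
      · exact exponentSliceAt_A_zero b (by norm_num [radA])
      · exact exponentSliceAt_A_one b (by norm_num [radA]))
    (fun b k => by funext U z; simp only [𝒬A, add_sub_cancel_left])
    hSg_A
    (fun _ k'' _ => (ϱA_le_three k'').trans_lt (by norm_num))
    (fun _ _ k _ _ => ϱA_succ_lt k)
    (fun b _ k _ _ => hmargin_A b k)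
    (fun _ _ => by rw [norm_cA, mA]; norm_num)
    (fun _ k p _ => ⟨by norm_num [δfA], by norm_num [δfA]⟩)
    (fun _ _ _ _ => by norm_num [δfA])
    (fun _ _ => ae_two.mpr ⟨zero_mem_Dfl, atomH_mem_Dfl⟩)
    (fun _ _ k _ _ _ => bondBall_add_mem (ρ' := radA (k + 1)) (s := 1 / 2) (ρ := radA k)
      (by simp only [radA]; push_cast; linarith))
    (fun _ _ k _ _ _ => bondBall_latMove_add_mem (ρ' := radA (k + 1)) (w := 1) (s := 1 / 2) (ρ := radA k)
      (by simp only [radA]; push_cast; linarith))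
    (fun _ _ k _ _ _ _ => bondBall_add_mem (ρ' := radA (k + 1)) (s := 1 / 2) (ρ := radA k)
      (by simp only [radA]; push_cast; linarith))
    (fun _ _ k _ _ _ _ U₀ hU₀ pd hpd hpdw t ht =>
      bondBall_complexMargin (ρ' := radA (k + 1)) (w := 1) (ϱ₁ := ϱ₁A k) (s := 1 / 2) (ρ := radA k) (ϱ₁A_pos k).le
        (by have := ϱ₁A_le_four k; simp only [radA]; push_cast; linarith) U₀ hU₀ pd hpd hpdw t ht z₁A z₁A_mem)
    (fun _ _ _ _ _ _ _ U₀ _ pd _ _ => ae_two.mpr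
      ⟨fun t _ => relGauge_pair (latMove U₀ pd t) 0 (Or.inl rfl), fun t _ => relGauge_pair (latMove U₀ pd t) atomH (Or.inr rfl)⟩)
    (fun _ _ z hz z' hz' x ν => by have h := bondBall_diam (s := 1 / 2) z hz z' hz' x ν; linarith)
    (fun _ _ => ⟨one_pos, le_rfl⟩) (fun _ _ _ => le_rfl)
    (fun _ _ _ => le_rfl) (fun _ _ _ => le_rfl)
    (fun _ _ k _ _ _ => by
      have h1 := one_le_ϱA k
      have h4 : 4 * (1 : ℝ) / ϱA k ≤ 4 := by
        rw [div_le_iff₀ (ϱA_pos k)]; linarith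
      nlinarith [five_mul_exp_three_le, Real.exp_pos 3])
    (fun _ _ _ _ _ h => h ▸ rfl)
    (fun _ _ _ _ _ => aesm_two _)
    (fun _ _ _ => by norm_num) (fun _ _ _ _ _ _ => by norm_num)
    (fun b k' k hb hk'k hk hran => hlin_A b k' k _ hb hk'k hk hran) }

/-! ## §3 END-B's per-cutoff face behind the moduli faces -/

/-- **END-F′-mod THEN END-B's PER-CUTOFF FACE, AT FUNCTION LEVEL** [decided toy]: from `DressedRoot.classAt_of_bookingLeaves` on
the bundle of §1 (transport leaf through the MODULI face): the booked observable-attached term of the datum lies in the two-rate class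
AND the dressed budget held at BOTH met steps `k = 0, 1`.  (Stated at the two scales, not as leaf-03's `∀ k ≤ K, RanBelow …` — that
statement is `classAt_through_ENDF''`, already in the tree; only the route differs.) [folklore] -/
theorem gates_through_ENDFmod :
    ClassAt Bk 64 128 1 ∧ budgetGate TrA sA mA SA (4 * (1 / 5) / 4) (fun _ => (1 : ℝ) * 128) 0 ∧
      budgetGate TrA sA mA SA (4 * (1 / 5) / 4) (fun _ => (1 : ℝ) * 128) 1 :=
  have h := classAt_of_bookingLeaves assembledLeavesMod
  ⟨h.1, h.2 2 le_rfl 0 (by norm_num), h.2 2 le_rfl 1 (by norm_num)⟩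

/-- **END-F′-mod-win THEN END-B's PER-CUTOFF FACE** [decided toy]: the same through the per-step-window moduli face (bundle of §2).
[folklore] -/
theorem gates_through_ENDFmodWin :
    ClassAt Bk 64 128 1 ∧ budgetGate TrA sA mA SA (4 * (1 / 5) / 4) (fun _ => (1 : ℝ) * 128) 0 ∧
      budgetGate TrA sA mA SA (4 * (1 / 5) / 4) (fun _ => (1 : ℝ) * 128) 1 :=
  have h := classAt_of_bookingLeaves assembledLeavesModWin
  ⟨h.1, h.2 2 le_rfl 0 (by norm_num), h.2 2 le_rfl 1 (by norm_num)⟩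

end Summit.QuantumFields.BalabanUV.T4Continuum.NE1p.DressedTransportAssembledModWitness

end
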